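import Literature.NumberTheory.EllipticCurves.CongruenceVisibilityMultiplicative
import Literature.NumberTheory.EllipticCurves.TateParametrisationTwistedTorsion
import HarnessLib

/-!
# Visible elements of `Ш(E/K)[p]` from a `p`-congruent curve, V: multiplicative places, split or not

`Proofs`-style file (theorems only: no definition, no new named fact) in topic
`NumberTheory/EllipticCurves`, sequel to `CongruenceVisibilityMultiplicative.lean` (the split
case). Written for the cell `b2b-bsdres` (run/shared/lean/b2b/bsd-rank1-residual/), whose HONEST
FRAMING applies to its use there: the goal of that cell is to DELETE the COMBINATION-SHAPED residual
classes for ALL analytic-rank `≤ 1` elliptic curves over `ℚ` — "full BSD formula for every rank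
`≤ 1` curve in class C" assembled STRICTLY from published theorems — so that the rank-`≤ 1`
remainder becomes exactly the CONSTRUCTION-SHAPED classes, which are TYPED (missing-input `Prop`s),
NOT attempted; this is not "finishing BSD". The theorems below sharpen ONE per-curve certificate
shape (visibility); they are general and cell-independent.

## The theorem

`WeierstrassCurve.h1Equiv_mem_selmerLocalKer_of_hasMultiplicativeReductionAt`: let `E = W`,
`E' = W'` be elliptic curves over a number field `K`, `p` an ODD prime, `θ : E'[p] ⥲ E[p]` a
`Γ_K`-isomorphism, and `v` a finite place — any residue characteristic, `v ∣ p` allowed — at which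
both curves have MULTIPLICATIVE reduction with `γ(E/K) ≡ γ(E'/K) mod K_v^{*2}` (`γ = −c₄/c₆`,
Silverman *ATAEC* V.5.2; i.e. both split, or both non-split with the same unramified quadratic
twist) and such that `K_v` contains no non-trivial `p`-th root of unity (`μ_p(K_v) = 1`; over `ℚ`:
`v ≢ 1 (mod p)`, always true at `v = p ≥ 3`). Then `θ_* 𝓢_v(E') ≤ 𝓢_v(E)`: the comparison index
`ι_v(θ)` of `CongruenceVisibilityComparison.lean` is `1`
(`relIndex_map_selmerLocalKer_eq_one_of_hasMultiplicativeReductionAt`). The split case under the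
alternative hypothesis `#E(K_v)[p] ≤ p` (which also covers `μ_p ⊂ K_v`) is
`CongruenceVisibilityMultiplicative.lean`. Packaged form over any number field:
`exists_sha_ne_zero_of_congr_of_rank_of_mult` — `E(K)` finite of order prime to `p`, a
`p`-congruent `E'` of rank `≥ 1`, and at each place of `S` one of: (`v ∤ p` and `E'(K_v)[p] = 0`),
(both split multiplicative and `#E(K_v)[p] ≤ p`), (both multiplicative, same `γ` class,
`μ_p(K_v) = 1`) ⇒ `Ш(E/K)[p] ≠ 0`. Over `ℚ` at `p = 3` this makes EVERY multiplicative place of a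
same-level congruence free of charge except split places `ℓ ≡ 1 (mod 3)` with `E[3] ⊂ E(ℚ_ℓ)`.

CONDITIONAL on the named facts `Silverman1994_thmV53_corV54_tateUniformisation` (twisted Tate
uniformisation; J. H. Silverman, *ATAEC*, Ch. V, Lemma 5.2 (c), Thm. 5.3, Cor. 5.4) and, for the
packaged form, `Silverman1994_thmV53_tateUniformisation` (file `TateUniformisation.lean`), taken as
hypotheses `hU2`, `hU`.

## Proof

As in the split case, with the twisted parametrisations `σ • Ψ(u) = Ψ((σu)^{ε(σ)})` (the two signs
`ε, ε'` agree because `√γ(E) = ± r √γ(E')`, `r ∈ K_v`): a class Selmer for `E'` at `v` is locally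
`σ ↦ σa' − a'`; replacing `a'` by `a₁ = (p+1)a'` (same coboundary, `pa'` being rational), the
rational point `pa₁ = (p+1)·pa'` has, by Cor. V.5.4 and `exists_twistInvariant_lift`, a preimage
`u'` INVARIANT under the twisted action; with `w^p = u'` the cocycle is `Ψ'(ζ_σ) + (σT − T)`,
`(σw)^{ε(σ)} = ζ_σ w`, `ζ_σ ∈ μ_p`, `T ∈ E'[p]`; the twisted dichotomy
(`exists_eq_nsmul_or_forall_map_eq_self`) matches the lines `Ψ'(μ_p) ↦ Ψ(μ_p)` under `θ` as
`ζ ↦ ζ^a` — the alternative, `Γ_{K_v}` fixing `ζ₀`, contradicts `μ_p(K_v) = 1`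
(`false_of_forall_map_primitiveRoot_eq`) — and `b = Ψ(w^a) + θT` trivialises the transported class.

## References

* [SilvermanATAEC1994] J. H. Silverman, *Advanced Topics in the Arithmetic of Elliptic Curves*,
  GTM 151 (1994), Ch. V, Lemma 5.2, Thm. 3.1, Thm. 5.3, Cor. 5.4.
* [CremonaMazur2000] J. E. Cremona, B. Mazur, Experiment. Math. 9 (2000) 13–28, §3.
* [AgasheStein2002] A. Agashe, W. Stein, J. Number Theory 97 (2002) 171–185, Thm. 3.1, §3.5.
* [MazurRubin2004] B. Mazur, K. Rubin, *Kolyvagin systems*, Mem. AMS 799 (2004), §2.3.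
-/

noncomputable section

open scoped Classical

open NumberField IsDedekindDomain Field

namespace WeierstrassCurve

open Literature.NumberTheory.EllipticCurves Literature.NumberTheory.GaloisRepresentations Field
open NumberField IsDedekindDomain

section Local

variable {K : Type} [Field K] [NumberField K] (W : WeierstrassCurve K) [W.IsElliptic]
  {p : ℕ} [hp : Fact p.Prime] (v : HeightOneSpectrum (𝓞 K))

/-- **The local Kummer conditions of two `p`-congruent curves agree at a place where both have
multiplicative reduction of the same twist type (split, or non-split with the same quadratic
character), when `K_v` contains no non-trivial `p`-th root of unity.** Let `E = W`, `E' = W'` be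
elliptic curves over a number field `K`, `p` an odd prime, `θ : E'[p] ⥲ E[p]` a `Γ_K`-isomorphism,
and `v` a finite place (any residue characteristic) at which both curves have multiplicative
reduction, with `γ(E/K) = r² γ(E'/K)` for some `r ∈ K_v` (`γ = −c₄/c₆`, Silverman *ATAEC* V.5.2:
the two curves become Tate curves over the SAME extension `K_v(√γ)` — both split, or both
non-split) and `μ_p(K_v) = 1`. Then `θ_* 𝓢_v(E') ≤ 𝓢_v(E)`. Conditional on the named fact
`Silverman1994_thmV53_corV54_tateUniformisation` (`hU`). Proof: as the split case
(`h1Equiv_mem_selmerLocalKer_of_hasSplitMultiplicativeReductionAt`) with the twisted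
parametrisations `σ • Ψ(u) = Ψ((σu)^{χ(σ)})`; the `K_v`-points are `Ψ'(u)`, `u ∈ L^*` of norm in
`q'^ℤ` (Cor. V.5.4), and replacing the trivialising point `a'` by `(p+1)a'` makes the norm
exponent even, so that `p(p+1)a' = Ψ'(u')` with `u' = u^{p+1} q'^{-(p+1)m/2}` INVARIANT for the
twisted action; the dichotomy `exists_eq_nsmul_or_forall_map_eq_self` leaves only the case where
`Γ_{K_v}` fixes `ζ₀`, excluded by `μ_p(K_v) = 1`. [cite: SilvermanATAEC1994, Ch. V Lemma 5.2 (c),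
Thm. 5.3, Cor. 5.4] [cite: CremonaMazur2000, §3] -/
theorem h1Equiv_mem_selmerLocalKer_of_hasMultiplicativeReductionAt
    (hU : Silverman1994_thmV53_corV54_tateUniformisation.{0}) (hp2 : p ≠ 2)
    (W' : WeierstrassCurve K) [W'.IsElliptic]
    (θ : geomTorsion W' (p : ℤ) ≃+ geomTorsion W (p : ℤ))
    (hθ : ∀ (σ : absoluteGaloisGroup K) (P : geomTorsion W' (p : ℤ)), θ (σ • P) = σ • θ P)
    (hW : W.HasMultiplicativeReductionAt v) (hW' : W'.HasMultiplicativeReductionAt v)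
    (hγ : ∃ r : (v.adicCompletion K), algebraMap K (v.adicCompletion K) (-(W.c₄ / W.c₆))
        = r ^ 2 * algebraMap K (v.adicCompletion K) (-(W'.c₄ / W'.c₆)))
    (hμ : ∀ ζ : (v.adicCompletion K), ζ ^ p = 1 → ζ = 1)
    {c : galH1Torsion W' (p : ℤ)} (hc : c ∈ selmerLocalKer W' (v.adicCompletion K) (p : ℤ)) :
    h1Equiv θ hθ c ∈ selmerLocalKer W (v.adicCompletion K) (p : ℤ) := by
  have hpp : p.Prime := hp.out
  haveI : NeZero p := ⟨hpp.ne_zero⟩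
  haveI : CharZero (v.adicCompletion K) := charZero_adicCompletion v
  haveI : CharZero (AlgebraicClosure (v.adicCompletion K)) := charZero_of_injective_algebraMap
      (algebraMap (v.adicCompletion K) (AlgebraicClosure (v.adicCompletion K))).injective
  have hn : (p : ℤ) ≠ 0 := by exact_mod_cast hpp.ne_zero
  obtain ⟨k₂, hk₂⟩ : ∃ k₂ : ℕ, p + 1 = 2 * k₂ := by
    obtain ⟨k, hk⟩ := hpp.odd_of_ne_two hp2
    exact ⟨k + 1, by omega⟩
  -- twisted Tate parametrisations of `E` and `E'` at `v`
  obtain ⟨q, t, Φ, hq0, hq1, ht0, ht2, -, hker, hequiv₀, -⟩ := hU W v hW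
  obtain ⟨q', t', Φ', hq0', hq1', ht0', ht2', -, hker', hequiv₀', hrat'⟩ := hU W' v hW'
  -- the two quadratic characters coincide (`t = ± r t'`)
  obtain ⟨r, hr⟩ := hγ
  have htt' : t = algebraMap (v.adicCompletion K) (AlgebraicClosure
      (v.adicCompletion K)) r * t' ∨ t = -(algebraMap (v.adicCompletion K) (AlgebraicClosure
      (v.adicCompletion K)) r * t') := by
    have h : t ^ 2 = (algebraMap (v.adicCompletion K) (AlgebraicClosure
        (v.adicCompletion K)) r * t') ^ 2 := by
      rw [ht2, hr, map_mul, map_pow, mul_pow, ht2']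
    exact sq_eq_sq_iff_eq_or_eq_neg.mp h
  have hr0 : algebraMap (v.adicCompletion K) (AlgebraicClosure (v.adicCompletion K)) r ≠ 0 := by
    intro h0
    rw [h0, zero_mul, neg_zero, or_self] at htt'
    exact ht0 htt'
  have hfixiff : ∀ σ : (absoluteGaloisGroup (v.adicCompletion K)),
      Field.absoluteGaloisGroup.toAlgEquiv (v.adicCompletion K) σ t = t ↔
        Field.absoluteGaloisGroup.toAlgEquiv (v.adicCompletion K) σ t' = t' := by
    intro σ
    rcases htt' with h | h
    · constructor
      · intro e
        rw [h, map_mul, AlgEquiv.commutes] at e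
        exact mul_left_cancel₀ hr0 e
      · intro e
        rw [h, map_mul, AlgEquiv.commutes, e]
    · constructor
      · intro e
        rw [h, map_neg, map_mul, AlgEquiv.commutes, neg_inj] at e
        exact mul_left_cancel₀ hr0 e
      · intro e
        rw [h, map_neg, map_mul, AlgEquiv.commutes, e]
  -- the common sign `ε(σ) = χ(σ)`
  obtain ⟨ε, hε_of_fix, hε_of_not⟩ : ∃ ε : (absoluteGaloisGroup (v.adicCompletion K)) → ℤ,
      (∀ σ, Field.absoluteGaloisGroup.toAlgEquiv (v.adicCompletion K) σ t' = t' → ε σ = 1) ∧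
        (∀ σ, Field.absoluteGaloisGroup.toAlgEquiv (v.adicCompletion K) σ t' ≠ t' → ε σ = -1) :=
    ⟨fun σ ↦ if Field.absoluteGaloisGroup.toAlgEquiv (v.adicCompletion K) σ t' = t' then 1 else -1,
      fun σ h ↦ if_pos h, fun σ h ↦ if_neg h⟩
  have hε : ∀ σ, ε σ = 1 ∨ ε σ = -1 := fun σ ↦ by
    by_cases h : Field.absoluteGaloisGroup.toAlgEquiv (v.adicCompletion K) σ t' = t'
    · exact Or.inl (hε_of_fix σ h)
    · exact Or.inr (hε_of_not σ h)
  have hequiv : ∀ (σ : (absoluteGaloisGroup (v.adicCompletion K))) (u : (AlgebraicClosure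
      (v.adicCompletion K))ˣ),
      σ • Φ (Additive.ofMul u) = Φ (Additive.ofMul ((Units.map
          (absoluteGaloisGroup.toAlgEquiv _ σ : AlgebraicClosure (v.adicCompletion K)
          →* AlgebraicClosure (v.adicCompletion K)) u) ^ (ε σ))) := by
    intro σ u
    rw [hequiv₀ σ u, ofMul_zpow, map_zsmul]
    by_cases h : Field.absoluteGaloisGroup.toAlgEquiv (v.adicCompletion K) σ t' = t'
    · rw [if_pos ((hfixiff σ).mpr h), hε_of_fix σ h]
    · rw [if_neg (fun h' ↦ h ((hfixiff σ).mp h')), hε_of_not σ h]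
  have hequiv' : ∀ (σ : (absoluteGaloisGroup (v.adicCompletion K))) (u : (AlgebraicClosure
      (v.adicCompletion K))ˣ),
      σ • Φ' (Additive.ofMul u) = Φ' (Additive.ofMul ((Units.map
          (absoluteGaloisGroup.toAlgEquiv _ σ : AlgebraicClosure (v.adicCompletion K)
          →* AlgebraicClosure (v.adicCompletion K)) u) ^ (ε σ))) := by
    intro σ u
    rw [hequiv₀' σ u, ofMul_zpow, map_zsmul]
    by_cases h : Field.absoluteGaloisGroup.toAlgEquiv (v.adicCompletion K) σ t' = t'
    · rw [if_pos h, hε_of_fix σ h]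
    · rw [if_neg h, hε_of_not σ h]
  -- the twisted action `u ↦ (σu)^{ε σ}` on `K̄_vˣ` is multiplicative and commutes with powers
  have hact_pow : ∀ (σ : (absoluteGaloisGroup (v.adicCompletion K))) (x : (AlgebraicClosure
      (v.adicCompletion K))ˣ) (n : ℕ),
      (Units.map (absoluteGaloisGroup.toAlgEquiv _ σ : AlgebraicClosure (v.adicCompletion K)
          →* AlgebraicClosure (v.adicCompletion K)) (x ^ n)) ^ (ε σ) = ((Units.map
          (absoluteGaloisGroup.toAlgEquiv _ σ : AlgebraicClosure (v.adicCompletion K)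
          →* AlgebraicClosure (v.adicCompletion K)) x) ^ (ε σ)) ^ n := by
    intro σ x n
    rw [map_pow, ← zpow_natCast, ← zpow_mul, mul_comm, zpow_mul, zpow_natCast]
  have hact_div : ∀ (σ : (absoluteGaloisGroup (v.adicCompletion K))) (x y : (AlgebraicClosure
      (v.adicCompletion K))ˣ),
      (Units.map (absoluteGaloisGroup.toAlgEquiv _ σ : AlgebraicClosure (v.adicCompletion K)
          →* AlgebraicClosure (v.adicCompletion K)) (x / y)) ^ (ε σ) = (Units.map
          (absoluteGaloisGroup.toAlgEquiv _ σ : AlgebraicClosure (v.adicCompletion K)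
          →* AlgebraicClosure (v.adicCompletion K)) x) ^ (ε σ) / (Units.map
          (absoluteGaloisGroup.toAlgEquiv _ σ : AlgebraicClosure (v.adicCompletion K)
          →* AlgebraicClosure (v.adicCompletion K)) y) ^ (ε σ) := by
    intro σ x y
    rw [map_div, div_zpow]
  -- a primitive `p`-th root of unity `ζ₀ = Z`
  obtain ⟨ζ₀, hζ₀⟩ := HasEnoughRootsOfUnity.exists_primitiveRoot (AlgebraicClosure
      (v.adicCompletion K)) p
  have hZu : IsUnit ζ₀ := hζ₀.isUnit hpp.ne_zero
  set Z : (AlgebraicClosure (v.adicCompletion K))ˣ := hZu.unit with hZdef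
  have hZ : IsPrimitiveRoot (Z : (AlgebraicClosure (v.adicCompletion K))) p := by
    rw [hZdef, IsUnit.unit_spec]; exact hζ₀
  have hZp : Z ^ p = 1 :=
    Units.ext (by rw [Units.val_pow_eq_pow_val, hZ.pow_eq_one, Units.val_one])
  -- the torsion comparison `E'[p](K̄) ≃ E'(K̄_v)[p]` and the transport `G = pointsMap ∘ θ ∘ e'⁻¹`
  set e' := W'.torsionPointsEquiv (p : ℤ) (E := (v.adicCompletion K)) hn with he'
  set G : AddSubgroup.torsionBy (localPoints W' (v.adicCompletion K)) (p : ℤ) →+ localPoints W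
      (v.adicCompletion K) :=
    ((pointsMap W (v.adicCompletion K)).comp (geomTorsion W (p : ℤ)).subtype).comp
      (θ.toAddMonoidHom.comp e'.symm.toAddMonoidHom) with hG
  have hG_apply : ∀ T, G T = pointsMap W (v.adicCompletion K) ((θ (e'.symm T) : geomTorsion W
      (p : ℤ)) :
      geomPoints W) := fun T ↦ rfl
  have hGsmul : ∀ (σ : (absoluteGaloisGroup (v.adicCompletion K))) (T : AddSubgroup.torsionBy
      (localPoints W' (v.adicCompletion K)) (p : ℤ)),
      G (σ • T) = σ • G T := by
    intro σ T
    rw [hG_apply, hG_apply, he', torsionPointsEquiv_symm_smul, hθ,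
      Literature.NumberTheory.EllipticCurves.AddSubgroup.torsionBy.coe_smul, pointsMap_smul]
  have hmem' : ∀ {ζ : (AlgebraicClosure (v.adicCompletion K))ˣ}, ζ ^ p = 1 →
      Φ' (Additive.ofMul ζ) ∈ AddSubgroup.torsionBy (localPoints W' (v.adicCompletion K)) (p : ℤ) :=
    fun hζ ↦ (Submodule.mem_torsionBy_iff _ _).mpr
        (W'.zsmul_map_ofMul_eq_zero_of_pow_eq_one v Φ' hζ)
  set XZ : AddSubgroup.torsionBy (localPoints W' (v.adicCompletion K)) (p : ℤ) := ⟨Φ'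
      (Additive.ofMul Z), hmem' hZp⟩
    with hXZ
  have hL₂p : (p : ℤ) • G XZ = 0 := by
    have h0 : (p : ℤ) • XZ = 0 := Subtype.ext (by
      rw [AddSubgroupClass.coe_zsmul, hXZ, AddSubgroup.coe_zero]
      exact W'.zsmul_map_ofMul_eq_zero_of_pow_eq_one v Φ' hZp)
    rw [← map_zsmul, h0, map_zero]
  have hL₂σ : ∀ (σ : (absoluteGaloisGroup (v.adicCompletion K))) (c : ℕ), (Units.map
      (absoluteGaloisGroup.toAlgEquiv _ σ : AlgebraicClosure (v.adicCompletion K)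
      →* AlgebraicClosure (v.adicCompletion K)) Z) ^ (ε σ) = Z ^ c →
      σ • G XZ = c • G XZ := by
    intro σ c hc
    have h1 : σ • XZ = c • XZ := Subtype.ext (by
      rw [Literature.NumberTheory.EllipticCurves.AddSubgroup.torsionBy.coe_smul,
        AddSubgroupClass.coe_nsmul, hXZ]
      change σ • Φ' (Additive.ofMul Z) = c • Φ' (Additive.ofMul Z)
      rw [hequiv', hc, ofMul_pow, map_nsmul])
    rw [← hGsmul, h1, map_nsmul]
  -- the dichotomy; the second alternative contradicts `μ_p(K_v) = 1`
  rcases W.exists_eq_nsmul_or_forall_map_eq_self v hq0 hq1 Φ hker ε hε hequiv hZ hL₂p hL₂σ with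
    ⟨a, ha⟩ | hfix
  swap
  · exact (false_of_forall_map_primitiveRoot_eq (K := K) v hμ hZ hfix).elim
  have hclaim : ∀ (ζ : (AlgebraicClosure (v.adicCompletion K))ˣ) (hζ : ζ ^ p = 1),
      G ⟨Φ' (Additive.ofMul ζ), hmem' hζ⟩ = Φ (Additive.ofMul (ζ ^ a)) := by
    intro ζ hζ
    obtain ⟨k, -, hk⟩ := hZ.eq_pow_of_pow_eq_one (ξ := (ζ : (AlgebraicClosure
        (v.adicCompletion K))))
      (by rw [← Units.val_pow_eq_pow_val, hζ, Units.val_one])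
    have hζk : ζ = Z ^ k := Units.ext (by rw [← hk, Units.val_pow_eq_pow_val])
    have hX : (⟨Φ' (Additive.ofMul ζ), hmem' hζ⟩ : AddSubgroup.torsionBy (localPoints W'
        (v.adicCompletion K)) (p : ℤ)) =
        k • XZ := Subtype.ext (by
      rw [AddSubgroupClass.coe_nsmul, hXZ]
      change Φ' (Additive.ofMul ζ) = k • Φ' (Additive.ofMul Z)
      rw [hζk, ofMul_pow, map_nsmul])
    rw [hX, map_nsmul, ha, hζk, ← pow_mul, ofMul_pow, map_nsmul, mul_nsmul']
  -- the class `c` and a point `a'` trivialising it locally for `E'`; we use `a₁ = a' + p a'`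
  obtain ⟨φ, rfl⟩ :=
    oneCocycleClass_surjective (discreteTopRep (absoluteGaloisGroup K) (geomTorsion W' (p : ℤ))) c
  rw [selmerLocalKer, oneCocycleClass_mem_resKer_iff] at hc
  obtain ⟨a', ha'⟩ := hc
  have ha'' : ∀ σ : (absoluteGaloisGroup (v.adicCompletion K)), pointsMap W' (v.adicCompletion K)
      ((φ.1 (resGal (K := K) (v.adicCompletion K) σ) : geomTorsion W' (p : ℤ)) :
      geomPoints W') = σ • a' - a' := fun σ ↦ ha' σ
  have hP'fix : ∀ σ : (absoluteGaloisGroup (v.adicCompletion K)), σ • ((p : ℤ) • a') = (p : ℤ)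
      • a' := by
    intro σ
    have h0 : (p : ℤ) • (σ • a' - a') = 0 := by
      rw [← ha'' σ, ← map_zsmul, (mem_geomTorsion_iff W' _ _).mp (φ.1 _).2, map_zero]
    rw [W'.smul_zsmul_localPoints (p : ℤ) σ a']
    rw [zsmul_sub, sub_eq_zero] at h0
    exact h0
  set a₁ : localPoints W' (v.adicCompletion K) := a' + (p : ℤ) • a' with ha₁
  have ha₁' : ∀ σ : (absoluteGaloisGroup (v.adicCompletion K)), pointsMap W' (v.adicCompletion K)
      ((φ.1 (resGal (K := K) (v.adicCompletion K) σ) : geomTorsion W' (p : ℤ)) :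
      geomPoints W') = σ • a₁ - a₁ := by
    intro σ
    rw [ha'' σ, ha₁, smul_add, hP'fix]
    abel
  have hpa₁ : (p : ℤ) • a₁ = (p + 1 : ℕ) • ((p : ℤ) • a') := by
    rw [ha₁, zsmul_add, succ_nsmul, ← natCast_zsmul ((p : ℤ) • a') p, add_comm]
  -- `p a' = Ψ'(u)` with `u ∈ L`, `N(u) ∈ q'^ℤ` (Cor. V.5.4); an invariant `u'` with
  -- `Ψ'(u') = (p+1) p a'` (`exists_twistInvariant_lift`)
  obtain ⟨u, huL, huN, hu⟩ := hrat' ((p : ℤ) • a') hP'fix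
  obtain ⟨u', hu'inv, hu'val⟩ := W'.exists_twistInvariant_lift v hq0' Φ' hker' ht2' ε hε_of_fix
    hε_of_not k₂ huL huN
  rw [hu, ← hk₂] at hu'val
  -- a `p`-th root `w` of `u'`, `R' = Φ'(w)` with `p R' = p a₁`, and `T = a₁ - R' ∈ E'[p]`
  obtain ⟨z, hz⟩ := IsAlgClosed.exists_pow_nat_eq (u' : (AlgebraicClosure
      (v.adicCompletion K))) hpp.pos
  have hz0 : z ≠ 0 := by
    rintro rfl
    rw [zero_pow hpp.ne_zero] at hz
    exact u'.ne_zero hz.symm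
  set w : (AlgebraicClosure (v.adicCompletion K))ˣ := Units.mk0 z hz0 with hw
  have hwp : w ^ p = u' := Units.ext (by rw [Units.val_pow_eq_pow_val, hw, Units.val_mk0, hz])
  set R' : localPoints W' (v.adicCompletion K) := Φ' (Additive.ofMul w) with hR'
  have hR'p : (p : ℤ) • R' = (p : ℤ) • a₁ := by
    rw [hR', ← map_zsmul, ← ofMul_zpow, zpow_natCast, hwp, hu'val, hpa₁]
  set T : localPoints W' (v.adicCompletion K) := a₁ - R' with hT
  have hTp : (p : ℤ) • T = 0 := by rw [hT, zsmul_sub, hR'p, sub_self]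
  set Tt : AddSubgroup.torsionBy (localPoints W' (v.adicCompletion K)) (p : ℤ) :=
    ⟨T, (Submodule.mem_torsionBy_iff _ _).mpr hTp⟩ with hTt
  set T₀ : geomTorsion W' (p : ℤ) := e'.symm Tt with hT₀
  have hT₀ : pointsMap W' (v.adicCompletion K) (T₀ : geomPoints W') = T := by
    rw [hT₀, he', W'.pointsMap_torsionPointsEquiv_symm (p : ℤ) hn Tt]
  -- `ζ_σ`, defined by `(σw)^{ε σ} = ζ_σ w`, is a `p`-th root of unity (`u'` is invariant)
  obtain ⟨ζf, hζf⟩ : ∃ ζf : (absoluteGaloisGroup (v.adicCompletion K)) → (AlgebraicClosure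
      (v.adicCompletion K))ˣ, ∀ σ, (Units.map
      (absoluteGaloisGroup.toAlgEquiv _ σ : AlgebraicClosure (v.adicCompletion K)
      →* AlgebraicClosure (v.adicCompletion K)) w) ^ (ε σ) = ζf σ * w :=
    ⟨fun σ ↦ (Units.map (absoluteGaloisGroup.toAlgEquiv _ σ : AlgebraicClosure
        (v.adicCompletion K) →* AlgebraicClosure (v.adicCompletion K)) w) ^ (ε σ) / w,
        fun σ ↦ by rw [div_mul_cancel]⟩
  have hζσ : ∀ σ : (absoluteGaloisGroup (v.adicCompletion K)), (ζf σ) ^ p = 1 := by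
    intro σ
    have h : ((Units.map (absoluteGaloisGroup.toAlgEquiv _ σ : AlgebraicClosure
        (v.adicCompletion K) →* AlgebraicClosure (v.adicCompletion K)) w) ^ (ε σ)) ^ p =
        (ζf σ * w) ^ p := by
      rw [hζf σ]
    rw [← hact_pow, hwp, hu'inv σ, mul_pow, hwp] at h
    exact (mul_right_cancel (by rw [one_mul]; exact h.symm)).symm.symm
  -- the cocycle of `E'`: `φ(σ) = e'⁻¹ Φ'(ζ_σ) + (σ T₀ - T₀)`
  have hφσ : ∀ σ : (absoluteGaloisGroup (v.adicCompletion K)), φ.1 (resGal (K := K)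
      (v.adicCompletion K) σ) =
      e'.symm ⟨Φ' (Additive.ofMul (ζf σ)), hmem' (hζσ σ)⟩ + (resGal (K := K)
          (v.adicCompletion K) σ • T₀ - T₀) := by
    intro σ
    apply Subtype.ext
    apply pointsMapOfEmb_injective W' (closureEmb (K := K) (v.adicCompletion K))
    change pointsMap W' (v.adicCompletion K) _ = pointsMap W' (v.adicCompletion K) _
    rw [ha₁' σ, AddSubgroup.coe_add, AddSubgroup.coe_sub, map_add (pointsMap W'
        (v.adicCompletion K)),
      map_sub (pointsMap W' (v.adicCompletion K)),
      Literature.NumberTheory.EllipticCurves.AddSubgroup.torsionBy.coe_smul, pointsMap_smul, hT₀,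
      he', W'.pointsMap_torsionPointsEquiv_symm (p : ℤ) hn]
    change σ • a₁ - a₁ = Φ' (Additive.ofMul (ζf σ)) + (σ • T - T)
    rw [hT, smul_sub, hR', hequiv' σ w, hζf σ, ofMul_mul, map_add Φ']
    abel
  -- the witness for `E`: `b = Φ(w^a) + θ T₀`
  rw [h1Equiv_oneCocycleClass, selmerLocalKer, oneCocycleClass_mem_resKer_iff]
  refine ⟨Φ (Additive.ofMul (w ^ a)) +
    pointsMap W (v.adicCompletion K) ((θ T₀ : geomTorsion W (p : ℤ)) : geomPoints W), fun σ ↦ ?_⟩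
  change pointsMap W (v.adicCompletion K) ((θ (φ.1 (resGal (K := K)
      (v.adicCompletion K) σ)) : geomTorsion W (p : ℤ)) :
    geomPoints W) = _
  have hwa : (Units.map (absoluteGaloisGroup.toAlgEquiv _ σ : AlgebraicClosure
      (v.adicCompletion K) →* AlgebraicClosure (v.adicCompletion K)) (w ^ a)) ^ (ε σ) =
      (ζf σ) ^ a * w ^ a := by
    rw [hact_pow, hζf σ, mul_pow]
  rw [hφσ σ, map_add θ, map_sub θ, AddSubgroup.coe_add, AddSubgroup.coe_sub,
    map_add (pointsMap W (v.adicCompletion K)), map_sub (pointsMap W (v.adicCompletion K)),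
        ← hG_apply, hclaim _ (hζσ σ), hθ,
    Literature.NumberTheory.EllipticCurves.AddSubgroup.torsionBy.coe_smul, pointsMap_smul,
    smul_add σ (Φ (Additive.ofMul (w ^ a))), hequiv σ (w ^ a), hwa, ofMul_mul, map_add Φ]
  abel

/-- **`ι_v(θ) = 1` at a place where both curves have multiplicative reduction of the same twist type
and `μ_p(K_v) = 1`** (the comparison index of `CongruenceVisibilityComparison.lean`), conditional on
the twisted Tate uniformisation (`hU2`). [cite: SilvermanATAEC1994, Ch. V Lemma 5.2 (c), Thm. 5.3,
Cor. 5.4] [cite: CremonaMazur2000, §3] -/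
theorem relIndex_map_selmerLocalKer_eq_one_of_hasMultiplicativeReductionAt
    (hU2 : Silverman1994_thmV53_corV54_tateUniformisation.{0}) (hp2 : p ≠ 2)
    (W' : WeierstrassCurve K) [W'.IsElliptic]
    (θ : geomTorsion W' (p : ℤ) ≃+ geomTorsion W (p : ℤ))
    (hθ : ∀ (σ : absoluteGaloisGroup K) (P : geomTorsion W' (p : ℤ)), θ (σ • P) = σ • θ P)
    (hW : W.HasMultiplicativeReductionAt v) (hW' : W'.HasMultiplicativeReductionAt v)
    (hγ : ∃ r : (v.adicCompletion K), algebraMap K (v.adicCompletion K) (-(W.c₄ / W.c₆))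
        = r ^ 2 * algebraMap K (v.adicCompletion K) (-(W'.c₄ / W'.c₆)))
    (hμ : ∀ ζ : (v.adicCompletion K), ζ ^ p = 1 → ζ = 1) :
    (selmerLocalKer W (v.adicCompletion K) (p : ℤ)).relIndex
        ((selmerLocalKer W' (v.adicCompletion K) (p : ℤ)).map (h1Equiv θ hθ).toAddMonoidHom) = 1 :=
  (relIndex_map_selmerLocalKer_eq_one_iff W W' θ hθ).mpr fun _ hc ↦
    W.h1Equiv_mem_selmerLocalKer_of_hasMultiplicativeReductionAt v hU2 hp2 W' θ hθ hW hW' hγ hμ hc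

/-- **Visible `Ш(E/K)[p] ≠ 0` from a `p`-congruent curve of rank `≥ 1`, with multiplicative places
free of charge.** Let `p` be an odd prime, `θ : E'[p] ⥲ E[p]` a `Γ_K`-isomorphism, `S` a finite set
of finite places outside which `E, E'` have good reduction and which contains the places above `p`;
assume `E(K)` is finite of order prime to `p`, `rank E'(K) ≥ 1`, and that every `v ∈ S` is of one
of three kinds: (i) `v ∤ p` and `E'(K_v)[p] = 0`; (ii) both curves split multiplicative at `v` and
`#E(K_v)[p] ≤ p`; (iii) both curves multiplicative at `v` with `γ(E/K) = r² γ(E'/K)` in `K_v` and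
`μ_p(K_v) = 1`. Then `Ш(E/K)` has a non-zero element killed by `p`
(`exists_sha_ne_zero_of_congr_of_rank_of_le` with the agreement at places of kinds (ii), (iii) from
the split / twisted comparison theorems; conditional on the Tate uniformisation facts `hU`, `hU2`).
[cite: CremonaMazur2000, §3 and Table 1] [cite: AgasheStein2002, Thm. 3.1 and §3.5]
[cite: SilvermanATAEC1994, Ch. V Thm. 3.1, Lemma 5.2, Thm. 5.3, Cor. 5.4] -/
theorem exists_sha_ne_zero_of_congr_of_rank_of_mult
    (hU : Silverman1994_thmV53_tateUniformisation.{0})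
    (hU2 : Silverman1994_thmV53_corV54_tateUniformisation.{0}) (hp2 : p ≠ 2)
    (W' : WeierstrassCurve K) [W'.IsElliptic]
    (θ : geomTorsion W' (p : ℤ) ≃+ geomTorsion W (p : ℤ))
    (hθ : ∀ (σ : absoluteGaloisGroup K) (P : geomTorsion W' (p : ℤ)), θ (σ • P) = σ • θ P)
    (S : Finset (HeightOneSpectrum (𝓞 K)))
    (hS : ∀ w : HeightOneSpectrum (𝓞 K), w ∉ S →
      W.HasGoodReductionAt w ∧ W'.HasGoodReductionAt w ∧ (p : 𝓞 K) ∉ w.asIdeal)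
    (hfin : Finite W.toAffine.Point) (hcop : (Nat.card W.toAffine.Point).Coprime p)
    (hrank : 1 ≤ W'.mordellWeilRank)
    (hplaces : ∀ w ∈ S,
      ((p : 𝓞 K) ∉ w.asIdeal ∧ Nat.card (nsmulAddMonoidHom p :
          (W'.baseChange (w.adicCompletion K)).toAffine.Point →+ _).ker = 1) ∨
      (W.HasSplitMultiplicativeReductionAt w ∧ W'.HasSplitMultiplicativeReductionAt w ∧
        Nat.card (nsmulAddMonoidHom p :
          (W.baseChange (w.adicCompletion K)).toAffine.Point →+ _).ker ≤ p) ∨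
      (W.HasMultiplicativeReductionAt w ∧ W'.HasMultiplicativeReductionAt w ∧
        (∃ r : w.adicCompletion K, algebraMap K (w.adicCompletion K) (-(W.c₄ / W.c₆)) =
          r ^ 2 * algebraMap K (w.adicCompletion K) (-(W'.c₄ / W'.c₆))) ∧
        (∀ ζ : w.adicCompletion K, ζ ^ p = 1 → ζ = 1))) :
    ∃ c : W.sha, c ≠ 0 ∧ p • c = 0 := by
  refine exists_sha_ne_zero_of_congr_of_rank_of_le W W' hp2 θ hθ S hS hfin hcop hrank
    (fun w hw hcase c hc ↦ ?_)
  rcases hplaces w hw with ⟨hwp, hloc⟩ | ⟨hWw, hW'w, hcardw⟩ | ⟨hWw, hW'w, hγw, hμw⟩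
  · exact absurd hcase (not_or.mpr ⟨hwp, not_not.mpr hloc⟩)
  · exact W.h1Equiv_mem_selmerLocalKer_of_hasSplitMultiplicativeReductionAt w hU W' θ hθ hWw hW'w
      hcardw hc
  · exact W.h1Equiv_mem_selmerLocalKer_of_hasMultiplicativeReductionAt w hU2 hp2 W' θ hθ hWw hW'w
      hγw hμw hc

end Local

end WeierstrassCurve

end
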